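import Literature.AlgebraicGeometry.ShimuraVarieties.HeckeCorrespondenceAction
import Mathlib.Analysis.Real.Sqrt
import Mathlib.Topology.Order.Compact

/-!
# The corner entry of a contact element is bounded (crux `EndoscopicMiddleDegree.OrthogonalEnveloped`,
# stmt-HodgeConjecture-14300; `--supports`; line `purity-sorted-hecke-envelope` / `HeckeGraphChow`, seat c2)

The last brick of "`Γ` acts properly discontinuously on the ball" (consumer: the landed assembly
`stub_archimedeanBoundOfBricks`). For a ball-quotient datum `D`, a Sylvester normalisation
`Tᴴ H^{τ₁} T = S = diag(1, …, 1, -1)` of its form at `τ₁` (`signature_τ₁`) and compact `K, L ⊆ 𝔹`: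
the corner entry `g_{last,last}` of `g = T⁻¹ γ^{τ₁} T ∈ U(S)` is bounded over the `γ ∈ Γ` with
`γ K ∩ L ≠ ∅`.

Proof (elementary, no hyperbolic metric). In Sylvester coordinates write `⟪y, z⟫ = ȳᵀ S z` and, for a
negative vector `v` (`⟪v, v⟫ < 0`), `N(v) = |v_last|² - Σ_{k<last} |v_k|² = -⟪v, v⟫ > 0` and
`σ(v) = |v_last| / √N(v)` — a scale-invariant continuous function on the cone, i.e. a continuous
function on the ball `𝔹 = cone / ℂˣ` (it is `cosh (d(o, ·)/2)` for the base point `o = [e_last]`).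
The KEY inequality (a hyperbolic triangle inequality through `o`): for negative `y`, `z`,
`|z_last| · N(y) ≤ 2 |y_last| · |⟪y, z⟫|` — by Cauchy–Schwarz `|⟪y, z⟫| ≥ |y_last| |z_last| - ‖y'‖ ‖z'‖
≥ |z_last| (|y_last| - ‖y'‖)` and `N(y) = (|y_last| - ‖y'‖)(|y_last| + ‖y'‖) ≤ (|y_last| - ‖y'‖) · 2|y_last|`.
Apply it to `y = g x` and `z = g e_last` (the last column of `g`, `N(z) = 1`): by invariance
`⟪g x, g e⟫ = ⟪x, e⟫ = -x̄_last` and `N(g x) = N(x)`, whence `|g_{last,last}| ≤ 2 σ(g x) σ(x)`. For a contact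
element, `x = T⁻¹ v_b` with `[v_b] = b ∈ K` and `[γ v_b] = γ b ∈ L`, so the two factors are bounded by the
maxima of the continuous function `[v] ↦ σ(T⁻¹ v)` on the compact sets `L` and `K`.

* `CornerBound.key` — the key inequality;
* `CornerBound.corner_le` — `|g_{last,last}| ≤ 2 σ(g x) σ(x)` for `g ∈ U(S)` and negative `x`;
* `stub_cornerBound` (REGISTERED stub of the crux).

References: BMM, N. Bergeron, J. Millson, C. Moeglin, arXiv:1306.1515 = Acta Math. 216 (2016), Part 2
§§1.1–1.4 (Sylvester form `H_{p,q}`, the ball of negative lines, `Γ`); W. Goldman, *Complex Hyperbolic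
Geometry* (1999), §3.1 (the distance `cosh²(d/2) = ⟪x,y⟫⟪y,x⟫/(⟪x,x⟫⟪y,y⟫)` on the ball).
-/

noncomputable section

-- The crux-workfile namespace `Summit.<P>.<Sub>.Cruxes.…` repeats `HodgeConjecture` (single-conjunct summit).
set_option linter.dupNamespace false

namespace Summit.HodgeConjecture.HodgeConjecture.Cruxes.OrthogonalEnveloped.HeckeGraphChow

open scoped BigOperators ComplexConjugate
open Matrix
open Literature.AlgebraicGeometry.Motives (SchemeOver)
open Literature.AlgebraicGeometry.ShimuraVarieties

namespace CornerBound

variable {p : ℕ}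

/-- The tangential square norm `Σ_{k<last} |v_k|²` of a vector of `ℂ^{p+1}`. [folklore] -/
def tailSq (v : Fin (p + 1) → ℂ) : ℝ := ∑ k : Fin p, ‖v k.castSucc‖ ^ 2

/-- `N(v) = |v_last|² - Σ_{k<last} |v_k|² = -⟪v, v⟫_S`, positive exactly on the negative cone of `S`.
[cite: BergeronMillsonMoeglin2016Balls, Part 2 §1.3] -/
def negNorm (v : Fin (p + 1) → ℂ) : ℝ := ‖v (Fin.last p)‖ ^ 2 - tailSq v

/-- `σ(v) = |v_last| / √N(v)`: on negative lines, `cosh` of half the distance to the base point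
`[e_last]` of the ball. [cite: Goldman1999ComplexHyperbolic, §3.1] -/
def ratio (v : Fin (p + 1) → ℂ) : ℝ := ‖v (Fin.last p)‖ / √(negNorm v)

/-- `0 ≤ Σ_{k<last} |v_k|²`. [folklore] -/
theorem tailSq_nonneg (v : Fin (p + 1) → ℂ) : 0 ≤ tailSq v :=
  Finset.sum_nonneg fun _ _ ↦ sq_nonneg _

/-- `0 ≤ σ(v)`. [folklore] -/
theorem ratio_nonneg (v : Fin (p + 1) → ℂ) : 0 ≤ ratio v :=
  div_nonneg (norm_nonneg _) (Real.sqrt_nonneg _)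

/-- The form of `S = diag(1, …, 1, -1)` in coordinates:
`v̄ᵀ S w = Σ_{k<last} conj(v_k) w_k - conj(v_last) w_last`. [cite: BergeronMillsonMoeglin2016Balls, Part 2 §1.1] -/
theorem form_eq (v w : Fin (p + 1) → ℂ) :
    star v ⬝ᵥ (signatureMatrix p *ᵥ w) =
      (∑ k : Fin p, conj (v k.castSucc) * w k.castSucc) - conj (v (Fin.last p)) * w (Fin.last p) := by
  simp only [dotProduct, signatureMatrix, mulVec_diagonal, Pi.star_apply, Complex.star_def]
  rw [Fin.sum_univ_castSucc]
  simp only [Fin.castSucc_ne_last, if_false, if_true]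
  ring

/-- `Re ⟪v, v⟫_S = -N(v)`. [cite: BergeronMillsonMoeglin2016Balls, Part 2 §1.3] -/
theorem form_self_re (v : Fin (p + 1) → ℂ) :
    (star v ⬝ᵥ (signatureMatrix p *ᵥ v)).re = -negNorm v := by
  rw [form_eq]
  simp only [Complex.conj_mul']
  have h : (∑ k : Fin p, ((‖v k.castSucc‖ : ℂ)) ^ 2) - ((‖v (Fin.last p)‖ : ℂ)) ^ 2 =
      ((tailSq v - ‖v (Fin.last p)‖ ^ 2 : ℝ) : ℂ) := by
    push_cast [tailSq]
    rfl
  rw [h, Complex.ofReal_re, negNorm]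
  ring

/-- Isometric change of variables in the form: `⟪g v, g w⟫_M = ⟪v, w⟫_{gᴴ M g}`. [folklore] -/
theorem form_mulVec_mulVec (g M : Matrix (Fin (p + 1)) (Fin (p + 1)) ℂ) (v w : Fin (p + 1) → ℂ) :
    star (g *ᵥ v) ⬝ᵥ (M *ᵥ (g *ᵥ w)) = star v ⬝ᵥ ((gᴴ * M * g) *ᵥ w) := by
  simp only [star_mulVec, mulVec_mulVec, dotProduct_mulVec, vecMul_vecMul, Matrix.mul_assoc]

/-- Isometries of `S` preserve `N`. [cite: BergeronMillsonMoeglin2016Balls, Part 2 §1.3] -/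
theorem negNorm_mulVec {g : Matrix (Fin (p + 1)) (Fin (p + 1)) ℂ}
    (hg : gᴴ * signatureMatrix p * g = signatureMatrix p) (v : Fin (p + 1) → ℂ) :
    negNorm (g *ᵥ v) = negNorm v := by
  have h := form_self_re (g *ᵥ v)
  rw [form_mulVec_mulVec, hg, form_self_re] at h
  linarith

/-- `N(c v) = |c|² N(v)`. [folklore] -/
theorem negNorm_smul (c : ℂ) (v : Fin (p + 1) → ℂ) : negNorm (c • v) = ‖c‖ ^ 2 * negNorm v := by
  simp only [negNorm, tailSq, Pi.smul_apply, smul_eq_mul, norm_mul, mul_pow, ← Finset.mul_sum]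
  ring

/-- `σ` is constant on punctured lines: `σ(c v) = σ(v)` for `c ≠ 0`. [folklore] -/
theorem ratio_smul {c : ℂ} (hc : c ≠ 0) (v : Fin (p + 1) → ℂ) : ratio (c • v) = ratio v := by
  simp only [ratio, negNorm_smul, Pi.smul_apply, smul_eq_mul, norm_mul]
  rw [Real.sqrt_mul (sq_nonneg _), Real.sqrt_sq (norm_nonneg _),
    mul_div_mul_left _ _ (norm_ne_zero_iff.2 hc)]

/-- `σ` is continuous where `N > 0`, as a function of a parameter. [folklore] -/
theorem continuous_ratio_comp {Y : Type*} [TopologicalSpace Y] {f : Y → Fin (p + 1) → ℂ}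
    (hf : Continuous f) (hpos : ∀ y, 0 < negNorm (f y)) : Continuous fun y ↦ ratio (f y) := by
  have h1 : Continuous fun y ↦ ‖f y (Fin.last p)‖ := ((continuous_apply _).comp hf).norm
  have h2 : Continuous fun y ↦ negNorm (f y) := by
    simp only [negNorm, tailSq]
    refine (h1.pow 2).sub (continuous_finsetSum _ fun k _ ↦ ?_)
    exact (((continuous_apply _).comp hf).norm).pow 2
  exact h1.div (Real.continuous_sqrt.comp h2) fun y ↦ (Real.sqrt_pos.2 (hpos y)).ne'

/-- **The key inequality** (a hyperbolic triangle inequality through the base point): for `y` negative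
and `z` non-positive, `|z_last| · N(y) ≤ 2 |y_last| · |⟪y, z⟫_S|`. Cauchy–Schwarz on the first `p`
coordinates gives `|⟪y, z⟫| ≥ |y_last||z_last| - ‖y'‖‖z'‖ ≥ |z_last| (|y_last| - ‖y'‖)`, and
`N(y) = (|y_last| - ‖y'‖)(|y_last| + ‖y'‖)`. [cite: Goldman1999ComplexHyperbolic, §3.1] -/
theorem key {y z : Fin (p + 1) → ℂ} (hy : 0 < negNorm y) (hz : 0 ≤ negNorm z) :
    ‖z (Fin.last p)‖ * negNorm y ≤
      2 * ‖y (Fin.last p)‖ * ‖star y ⬝ᵥ (signatureMatrix p *ᵥ z)‖ := by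
  set A := ‖y (Fin.last p)‖ with hA
  set Z := ‖z (Fin.last p)‖ with hZ
  set ny := √(tailSq y) with hny
  set nz := √(tailSq z) with hnz
  have hA0 : 0 ≤ A := norm_nonneg _
  have hZ0 : 0 ≤ Z := norm_nonneg _
  have hny0 : 0 ≤ ny := Real.sqrt_nonneg _
  have hny2 : ny ^ 2 = tailSq y := Real.sq_sqrt (tailSq_nonneg y)
  have hnyA : ny < A := by
    have h : tailSq y < A ^ 2 := by rw [negNorm] at hy; linarith
    exact (Real.sqrt_lt_sqrt (tailSq_nonneg y) h).trans_eq (Real.sqrt_sq hA0)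
  have hnzZ : nz ≤ Z := by
    have h : tailSq z ≤ Z ^ 2 := by rw [negNorm] at hz; linarith
    exact (Real.sqrt_le_sqrt h).trans_eq (Real.sqrt_sq hZ0)
  -- Cauchy–Schwarz on the first `p` coordinates
  have hcs : ‖∑ k : Fin p, conj (y k.castSucc) * z k.castSucc‖ ≤ ny * nz := by
    refine (norm_sum_le _ _).trans ?_
    have h := Real.sum_mul_le_sqrt_mul_sqrt Finset.univ (fun k : Fin p ↦ ‖y k.castSucc‖)
      (fun k ↦ ‖z k.castSucc‖)
    simpa only [norm_mul, Complex.norm_conj, hny, hnz, tailSq] using h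
  -- the form is bounded below
  have hB : A * Z - ny * nz ≤ ‖star y ⬝ᵥ (signatureMatrix p *ᵥ z)‖ := by
    rw [form_eq]
    have h1 : ‖conj (y (Fin.last p)) * z (Fin.last p)‖ = A * Z := by rw [norm_mul, Complex.norm_conj]
    calc A * Z - ny * nz
        ≤ ‖conj (y (Fin.last p)) * z (Fin.last p)‖ - ‖∑ k : Fin p, conj (y k.castSucc) * z k.castSucc‖ := by
          rw [h1]; linarith
      _ ≤ ‖conj (y (Fin.last p)) * z (Fin.last p) - ∑ k : Fin p, conj (y k.castSucc) * z k.castSucc‖ :=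
          norm_sub_norm_le _ _
      _ = ‖(∑ k : Fin p, conj (y k.castSucc) * z k.castSucc) - conj (y (Fin.last p)) * z (Fin.last p)‖ :=
          norm_sub_rev _ _
  set b := ‖star y ⬝ᵥ (signatureMatrix p *ᵥ z)‖ with hb
  have hnz0 : 0 ≤ nz := Real.sqrt_nonneg _
  have hB' : Z * (A - ny) ≤ b := by nlinarith [mul_nonneg hny0 (sub_nonneg.2 hnzZ)]
  have hfin : Z * (A ^ 2 - ny ^ 2) ≤ 2 * A * b := by
    nlinarith [mul_nonneg hA0 (sub_nonneg.2 hB'), mul_nonneg hZ0 (sq_nonneg (A - ny))]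
  have hN : negNorm y = A ^ 2 - ny ^ 2 := by rw [hny2, negNorm]
  rw [hN]
  exact hfin

/-- **The corner entry of an isometry of `S` is controlled by how far it moves one negative line**:
for `gᴴ S g = S` and `x` negative, `|g_{last,last}| ≤ 2 σ(g x) σ(x)`. (Key inequality for `y = g x` and
`z = g e_last`, the last column of `g`, using `⟪g x, g e⟫ = ⟪x, e⟫ = -x̄_last`, `N(g e) = N(e) = 1`,
`N(g x) = N(x)`.) [cite: Goldman1999ComplexHyperbolic, §3.1] -/
theorem corner_le {g : Matrix (Fin (p + 1)) (Fin (p + 1)) ℂ}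
    (hg : gᴴ * signatureMatrix p * g = signatureMatrix p) {x : Fin (p + 1) → ℂ} (hx : 0 < negNorm x) :
    ‖g (Fin.last p) (Fin.last p)‖ ≤ 2 * ratio (g *ᵥ x) * ratio x := by
  set e : Fin (p + 1) → ℂ := Pi.single (Fin.last p) 1 with he
  have hcl : (g *ᵥ e) (Fin.last p) = g (Fin.last p) (Fin.last p) := by
    rw [he, mulVec_single_one, col_apply]
  have hNe : negNorm e = 1 := by
    simp [negNorm, tailSq, he, Fin.castSucc_ne_last]
  have hNc : negNorm (g *ᵥ e) = 1 := by rw [negNorm_mulVec hg, hNe]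
  have hform : star (g *ᵥ x) ⬝ᵥ (signatureMatrix p *ᵥ (g *ᵥ e)) = -conj (x (Fin.last p)) := by
    rw [form_mulVec_mulVec, hg, form_eq]
    simp [he, Fin.castSucc_ne_last]
  have hkey := key (y := g *ᵥ x) (z := g *ᵥ e) (by rwa [negNorm_mulVec hg]) (by rw [hNc]; exact zero_le_one)
  rw [hcl, negNorm_mulVec hg, hform, norm_neg, Complex.norm_conj] at hkey
  -- `hkey : ‖g last last‖ * N(x) ≤ 2 ‖(g x) last‖ ‖x last‖`
  simp only [ratio]
  rw [negNorm_mulVec hg]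
  have hs : √(negNorm x) * √(negNorm x) = negNorm x := Real.mul_self_sqrt hx.le
  rw [show 2 * (‖(g *ᵥ x) (Fin.last p)‖ / √(negNorm x)) * (‖x (Fin.last p)‖ / √(negNorm x)) =
      2 * ‖(g *ᵥ x) (Fin.last p)‖ * ‖x (Fin.last p)‖ / (√(negNorm x) * √(negNorm x)) by ring,
    hs, le_div_iff₀ hx]
  exact hkey

end CornerBound

open CornerBound in
/-- **REGISTERED STUB `stub_cornerBound` (seat c2): the corner entry of the Sylvester conjugate of a
contact element is bounded.** For a ball-quotient datum `D`, `T` with `Tᴴ H^{τ₁} T = S` and compact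
`K, L ⊆ 𝔹`, there is `C` with `|(T⁻¹ γ^{τ₁} T)_{last,last}| ≤ C` for every `γ ∈ Γ` with `γ K ∩ L ≠ ∅`:
in Sylvester coordinates `γ` acts by `g = T⁻¹ γ^{τ₁} T ∈ U(S)`, and `|g_{last,last}| ≤ 2 σ(g x_b) σ(x_b)`
(`corner_le`) with both factors bounded by the maxima on `L`, `K` of the continuous function on the ball
induced by the scale-invariant `v ↦ σ(T⁻¹ v)`. [cite: BergeronMillsonMoeglin2016Balls, Part 2 §1.4] -/
theorem stub_cornerBound :
    ∀ {p : ℕ} {X : SchemeOver ℂ} (D : UnitaryBallQuotientDatum p X) (T : GL (Fin (p + 1)) ℂ),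
      (T : Matrix (Fin (p + 1)) (Fin (p + 1)) ℂ)ᴴ * D.Hℂ * (T : Matrix (Fin (p + 1)) (Fin (p + 1)) ℂ) =
        signatureMatrix p →
      ∀ (K L : Set D.ball), IsCompact K → IsCompact L →
        ∃ C : ℝ, ∀ γ : ↥D.Γ, (∃ b ∈ K, γ • b ∈ L) →
          ‖((T⁻¹ * Matrix.GeneralLinearGroup.map D.τ₁ (γ : GL (Fin (p + 1)) D.E) * T :
              GL (Fin (p + 1)) ℂ) : Matrix (Fin (p + 1)) (Fin (p + 1)) ℂ) (Fin.last p) (Fin.last p)‖ ≤ C := by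
  intro p X D T hT K L hK hL
  set Tm : Matrix (Fin (p + 1)) (Fin (p + 1)) ℂ := (↑T : Matrix (Fin (p + 1)) (Fin (p + 1)) ℂ) with hTm
  set Ti : Matrix (Fin (p + 1)) (Fin (p + 1)) ℂ :=
    ((T⁻¹ : GL (Fin (p + 1)) ℂ) : Matrix (Fin (p + 1)) (Fin (p + 1)) ℂ) with hTi
  have hTmTi : Tm * Ti = 1 := by
    rw [hTm, hTi, ← Units.val_mul, mul_inv_cancel, Units.val_one]
  -- `Hℂ = T⁻ᴴ S T⁻¹`
  have hHc : Tiᴴ * signatureMatrix p * Ti = D.Hℂ := by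
    rw [← hT]
    calc Tiᴴ * (Tmᴴ * D.Hℂ * Tm) * Ti = (Tm * Ti)ᴴ * D.Hℂ * (Tm * Ti) := by
          rw [Matrix.conjTranspose_mul]; simp only [Matrix.mul_assoc]
      _ = D.Hℂ := by rw [hTmTi, Matrix.conjTranspose_one, Matrix.one_mul, Matrix.mul_one]
  -- Sylvester coordinates of cone vectors are `S`-negative
  have hpos : ∀ v : D.cone, 0 < negNorm (Ti *ᵥ (v : Fin (p + 1) → ℂ)) := fun v ↦ by
    have h := form_self_re (Ti *ᵥ (v : Fin (p + 1) → ℂ))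
    rw [form_mulVec_mulVec, hHc] at h
    have hv := mem_negCone_iff.1 v.2
    linarith
  -- the continuous function `[v] ↦ σ(T⁻¹ v)` on the ball
  have hcont : Continuous fun v : D.cone ↦ ratio (Ti *ᵥ (v : Fin (p + 1) → ℂ)) :=
    continuous_ratio_comp (continuous_const.matrix_mulVec continuous_subtype_val) hpos
  let ψ : D.ball → ℝ := Quotient.lift (fun v : D.cone ↦ ratio (Ti *ᵥ (v : Fin (p + 1) → ℂ)))
    fun v w h ↦ by
      obtain ⟨c, rfl⟩ := MulAction.orbitRel_apply.1 h
      change ratio (Ti *ᵥ ((c : ℂ) • (w : Fin (p + 1) → ℂ))) = ratio (Ti *ᵥ (w : Fin (p + 1) → ℂ))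
      rw [mulVec_smul, ratio_smul c.ne_zero]
  have hψ : Continuous ψ := continuous_quot_lift _ hcont
  have hψ_mk : ∀ v : D.cone, ψ (D.toBall v) = ratio (Ti *ᵥ (v : Fin (p + 1) → ℂ)) := fun v ↦ rfl
  obtain ⟨MK, hMK⟩ := hK.bddAbove_image hψ.continuousOn
  obtain ⟨ML, hML⟩ := hL.bddAbove_image hψ.continuousOn
  refine ⟨2 * ML * MK, fun γ ⟨b, hbK, hbL⟩ ↦ ?_⟩
  obtain ⟨v, rfl⟩ := D.toBall_surjective b
  have hK' : ratio (Ti *ᵥ (v : Fin (p + 1) → ℂ)) ≤ MK := by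
    rw [← hψ_mk]; exact hMK (Set.mem_image_of_mem ψ hbK)
  have hL' : ratio (Ti *ᵥ D.act (γ : GL (Fin (p + 1)) D.E) (v : Fin (p + 1) → ℂ)) ≤ ML := by
    rw [UnitaryBallQuotientDatum.smul_toBall] at hbL
    have h := hML (Set.mem_image_of_mem ψ hbL)
    rwa [hψ_mk] at h
  -- the Sylvester conjugate `g = T⁻¹ γ^{τ₁} T`
  set Gm : Matrix (Fin (p + 1)) (Fin (p + 1)) ℂ :=
    ((γ : GL (Fin (p + 1)) D.E) : Matrix (Fin (p + 1)) (Fin (p + 1)) D.E).map D.τ₁ with hGm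
  have hGu : Gmᴴ * D.Hℂ * Gm = D.Hℂ :=
    D.conjTranspose_mul_Hℂ_mul (D.isCongruenceSubgroup.1 γ.2)
  have hval : ((T⁻¹ * Matrix.GeneralLinearGroup.map D.τ₁ (γ : GL (Fin (p + 1)) D.E) * T :
      GL (Fin (p + 1)) ℂ) : Matrix (Fin (p + 1)) (Fin (p + 1)) ℂ) = Ti * Gm * Tm := by
    rw [Units.val_mul, Units.val_mul]
    rfl
  have hg : (Ti * Gm * Tm)ᴴ * signatureMatrix p * (Ti * Gm * Tm) = signatureMatrix p := by
    calc (Ti * Gm * Tm)ᴴ * signatureMatrix p * (Ti * Gm * Tm)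
        = Tmᴴ * (Gmᴴ * (Tiᴴ * signatureMatrix p * Ti) * Gm) * Tm := by
          simp only [Matrix.conjTranspose_mul, Matrix.mul_assoc]
      _ = signatureMatrix p := by rw [hHc, hGu, hT]
  have hgx : (Ti * Gm * Tm) *ᵥ (Ti *ᵥ (v : Fin (p + 1) → ℂ)) = Ti *ᵥ (Gm *ᵥ (v : Fin (p + 1) → ℂ)) := by
    calc (Ti * Gm * Tm) *ᵥ (Ti *ᵥ (v : Fin (p + 1) → ℂ)) = (Ti * Gm * Tm * Ti) *ᵥ (v : Fin (p + 1) → ℂ) := by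
          rw [mulVec_mulVec]
      _ = (Ti * Gm) *ᵥ (v : Fin (p + 1) → ℂ) := by rw [Matrix.mul_assoc (Ti * Gm), hTmTi, Matrix.mul_one]
      _ = Ti *ᵥ (Gm *ᵥ (v : Fin (p + 1) → ℂ)) := by rw [mulVec_mulVec]
  have hc := corner_le hg (hpos v)
  rw [hgx] at hc
  rw [hval]
  have hL'' : ratio (Ti *ᵥ (Gm *ᵥ (v : Fin (p + 1) → ℂ))) ≤ ML := hL'
  have h0 : 0 ≤ ratio (Ti *ᵥ (Gm *ᵥ (v : Fin (p + 1) → ℂ))) := ratio_nonneg _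
  have h1 : 0 ≤ ratio (Ti *ᵥ (v : Fin (p + 1) → ℂ)) := ratio_nonneg _
  have hML0 : 0 ≤ ML := h0.trans hL''
  calc ‖(Ti * Gm * Tm) (Fin.last p) (Fin.last p)‖
      ≤ 2 * ratio (Ti *ᵥ (Gm *ᵥ (v : Fin (p + 1) → ℂ))) * ratio (Ti *ᵥ (v : Fin (p + 1) → ℂ)) := hc
    _ ≤ 2 * ML * MK := by
        have := mul_le_mul hL'' hK' h1 hML0
        linarith

end Summit.HodgeConjecture.HodgeConjecture.Cruxes.OrthogonalEnveloped.HeckeGraphChow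

end
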